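import Summits.QuantumFields.BalabanUV.InfraRed.StrongCouplingStaggerPhaseWeights
import Summits.QuantumFields.BalabanUV.InfraRed.StrongCouplingWeightedForestDoor
import Summits.QuantumFields.BalabanUV.InfraRed.StrongCouplingQuarterModulusTwoSevenths
import Summits.QuantumFields.BalabanUV.InfraRed.StrongCouplingDoorCeilings
import Summits.QuantumFields.BalabanUV.InfraRed.StrongCouplingFrontSummary
import HarnessLib

/-!
# The sixteen-class weighted forest door: SC-b below `β_W = 4000/14223 = 0.2812…` (SU(2)), hypothesis-free

Observatory of the non-perturbative crossover; no mass-gap claim.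

ABSOLUTE RULE of this package: no internally-minted statement enters as a cited fact; every hypothesis is either
kernel-proved in this package or a verbatim quotation of a PUBLISHED theorem with page reference. The manuscript(s)
under audit are not citable for their own disputed steps. Everything below is assembled from kernel theorems of this
package over Mathlib's Haar measure; no literature axiom is invoked.

LEDGER CURRENCY: SC-b, `CrossoverLedger.StrongCouplingFront (fundamentalLatticeRep 2) (β₀W/2)` (uniform exponential
clustering of gauge-invariant local observables on all `[0, β₀W/2]`, odd tori `(ZMod (2S+1))^4`, every `S ≥ S₀`).
Units: tree coupling `β = β_W/2` for `SU(2)` (`UNITS.md`), `β_W = 4/g²`.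

THE TABLE (W4c, window `{−6, …, 9}`). Phase-class weights `phaseWeight wideU uT` on the staggered temporal forest
(`StrongCouplingStaggerPhaseWeights`): a space-like link of class `a` weighs `wideU a`, symmetric under `a ↦ 3 − a`,
with the eight levels `1.4703, 1.4976, 1.3018, 1.2471, 1.15, 1.1037, 1.0494, 1.0237` on the class pairs
`{0,3}, {1,2}, {−1,4}, {−2,5}, {−3,6}, {−4,7}, {−5,8}, {−6,9}` and `1` elsewhere; a time-like link weighs `uT = 1.2521`.
With `ρ = 14223/1000` the row conditions of `weightedRow_phase_le` hold on every odd torus of side `L ≥ 23`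
(`sixteenClass_rows`: twenty integer cases `valMinAbs a ∈ [−8, 11]` plus the far classes, where the row is `14 ≤ ρ`).
The optimum of this family is `ρ* = 14.2222`; the infinite-window limit is `≈ 14.14` (`β_W ≈ 0.2829 < 2/7`), so the
quarter modulus up to `2/7` always suffices and this lever ends there.

CONSEQUENCE. Through the weighted forest door (weights in `[1, 936/625]`) and the quarter modulus up to `2/7`:
**SC-b at every Wilson `β₀W < 4/ρ = 4000/14223 = 0.28123…`** (`su2_strongCouplingFront_lt_sixteenClass`; was `200/723`
five-class, `5000/18513` two-class, `4/15` uniform), instance `β_W = 0.28`, bare coupling `g² > 14.223`; the ceiling is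
a theorem (`su2_sixteenClassDoor_iff`). Gain over `4/15`: `+5.46 %`.

NOT CLAIMED: SC-b at or above `β_W = 4000/14223`; any DLR statement (SC-a stays `β_W < 2/9`); SC-c is `β_W < 2/7`
elsewhere; N ≥ 3; no mass-gap claim.  All (K)-grade: kernel theorems over Mathlib's Haar measure, hypothesis-free.
-/

noncomputable section

open Literature.MathematicalPhysics.QuantumFieldTheory
open Literature.MathematicalPhysics.QuantumLattice (fundamentalRep fundamentalLatticeRep)
open Literature.MathematicalPhysics.QuantumFieldTheory.Balaban1983to89
open Literature.MathematicalPhysics.QuantumFieldTheory.Balaban1983to89.StrongCouplingDobrushinWindow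
open Summit.QuantumFields.BalabanUV.InfraRed.StrongCouplingForestGauge
open Summit.QuantumFields.BalabanUV.InfraRed.StrongCouplingStaggerForest
open Summit.QuantumFields.BalabanUV.InfraRed.StrongCouplingWeightedFrozenCovariance (WeightedForestRowBound)
open Summit.QuantumFields.BalabanUV.InfraRed.StrongCouplingWeightedForestDoor (su2_weightedForestDoor)
open Summit.QuantumFields.BalabanUV.InfraRed.StrongCouplingStaggerPhaseWeights
open Summit.QuantumFields.BalabanUV.InfraRed.StrongCouplingQuarterModulusTwoSevenths (oneLinkKRModulusSU2_of_le_twoSevenths)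
open Summit.QuantumFields.BalabanUV.InfraRed.StrongCouplingDoorCeilings (door_iff)
open Literature.MathematicalPhysics.QuantumFieldTheory.Balaban1983to89.StrongCouplingTorusWindow (krRate)
open Summit.QuantumFields.BalabanUV.InfraRed.StrongCouplingFrontSummary (su2_strongCouplingFronts su2_strongCouplingFronts_ceilings)

namespace Summit.QuantumFields.BalabanUV.InfraRed.StrongCouplingSixteenClassFront

/-! ## 1. The sixteen-class table on `ZMod L` -/

section Table

variable {L : ℕ} [NeZero L]

/-- **Sixteen-class space-like weights** by staggering-phase class (window `{−6, …, 9}`, symmetric under `a ↦ 3 − a`),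
`1` elsewhere. [folklore] -/
def wideU (a : ZMod L) : ℝ :=
  if a = 0 ∨ a = 3 then 14703 / 10000 else if a = 1 ∨ a = 2 then 936 / 625 else if a = -1 ∨ a = 4 then 6509 / 5000
  else if a = -2 ∨ a = 5 then 12471 / 10000 else if a = -3 ∨ a = 6 then 23 / 20 else if a = -4 ∨ a = 7 then 11037 / 10000
  else if a = -5 ∨ a = 8 then 5247 / 5000 else if a = -6 ∨ a = 9 then 10237 / 10000 else 1

/-- A residue equals a small integer `c` (`|c| ≤ 11`, `L ≥ 23`) iff its least-absolute-value lift is `c`. [folklore] -/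
theorem eq_intCast_iff_valMinAbs (hL : 23 ≤ L) (a : ZMod L) (c : ℤ) (hc : -11 ≤ c ∧ c ≤ 11) :
    a = (c : ZMod L) ↔ a.valMinAbs = c := by
  rw [ZMod.valMinAbs_spec]
  constructor
  · intro h
    refine ⟨h, ?_, ?_⟩ <;> omega
  · exact fun h => h.1

omit [NeZero L] in
/-- The table values on the classes `0, 1, 2, 3`. [folklore] -/
theorem wideU_window (hL : 4 ≤ L) :
    wideU (0 : ZMod L) = 14703 / 10000 ∧ wideU (1 : ZMod L) = 936 / 625 ∧ wideU (2 : ZMod L) = 936 / 625 ∧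
      wideU (3 : ZMod L) = 14703 / 10000 := by
  obtain ⟨h01, h02, h03, h12, h13, h23⟩ := zmod_small_ne hL
  refine ⟨by simp [wideU], ?_, ?_, by simp [wideU]⟩
  · simp [wideU, h01.symm, h13]
  · simp [wideU, h02.symm, h23, h12.symm]

omit [NeZero L] in
/-- The table lies in `[1, 936/625]`. [folklore] -/
theorem wideU_mem (a : ZMod L) : 1 ≤ wideU a ∧ wideU a ≤ 936 / 625 := by
  unfold wideU
  split_ifs <;> constructor <;> norm_num

set_option maxHeartbeats 800000 in
/-- **The sixteen-class row conditions at `ρ = 14223/1000`** (`L ≥ 23`): for every class `a`,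
`4u(a−2) + 4u(a) + 4u(a+2) + u(a+1) + u(a−1) + ([a=2]+[a=0]+[a=3]+[a=1]) uT ≤ ρ u(a)` with `u = wideU`,
`uT = 12521/10000` — twenty integer cases `valMinAbs a ∈ [−8, 11]` and the far classes. [folklore] -/
theorem sixteenClass_rows (hL : 23 ≤ L) (a : ZMod L) :
    4 * wideU (a - 2) + 4 * wideU a + 4 * wideU (a + 2) + wideU (a + 1) + wideU (a - 1) +
      ((if a = 2 then (12521 / 10000 : ℝ) else 0) + (if a = 0 then (12521 / 10000 : ℝ) else 0) +
        (if a = 3 then (12521 / 10000 : ℝ) else 0) + (if a = 1 then (12521 / 10000 : ℝ) else 0)) ≤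
      14223 / 1000 * wideU a := by
  have im8 : a = -8 ↔ a.valMinAbs = -8 := by simpa using eq_intCast_iff_valMinAbs hL a (-8) (by norm_num)
  have im7 : a = -7 ↔ a.valMinAbs = -7 := by simpa using eq_intCast_iff_valMinAbs hL a (-7) (by norm_num)
  have im6 : a = -6 ↔ a.valMinAbs = -6 := by simpa using eq_intCast_iff_valMinAbs hL a (-6) (by norm_num)
  have im5 : a = -5 ↔ a.valMinAbs = -5 := by simpa using eq_intCast_iff_valMinAbs hL a (-5) (by norm_num)
  have im4 : a = -4 ↔ a.valMinAbs = -4 := by simpa using eq_intCast_iff_valMinAbs hL a (-4) (by norm_num)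
  have im3 : a = -3 ↔ a.valMinAbs = -3 := by simpa using eq_intCast_iff_valMinAbs hL a (-3) (by norm_num)
  have im2 : a = -2 ↔ a.valMinAbs = -2 := by simpa using eq_intCast_iff_valMinAbs hL a (-2) (by norm_num)
  have im1 : a = -1 ↔ a.valMinAbs = -1 := by simpa using eq_intCast_iff_valMinAbs hL a (-1) (by norm_num)
  have i0 : a = 0 ↔ a.valMinAbs = 0 := (ZMod.valMinAbs_eq_zero a).symm
  have i1 : a = 1 ↔ a.valMinAbs = 1 := by simpa using eq_intCast_iff_valMinAbs hL a 1 (by norm_num)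
  have i2 : a = 2 ↔ a.valMinAbs = 2 := by simpa using eq_intCast_iff_valMinAbs hL a 2 (by norm_num)
  have i3 : a = 3 ↔ a.valMinAbs = 3 := by simpa using eq_intCast_iff_valMinAbs hL a 3 (by norm_num)
  have i4 : a = 4 ↔ a.valMinAbs = 4 := by simpa using eq_intCast_iff_valMinAbs hL a 4 (by norm_num)
  have i5 : a = 5 ↔ a.valMinAbs = 5 := by simpa using eq_intCast_iff_valMinAbs hL a 5 (by norm_num)
  have i6 : a = 6 ↔ a.valMinAbs = 6 := by simpa using eq_intCast_iff_valMinAbs hL a 6 (by norm_num)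
  have i7 : a = 7 ↔ a.valMinAbs = 7 := by simpa using eq_intCast_iff_valMinAbs hL a 7 (by norm_num)
  have i8 : a = 8 ↔ a.valMinAbs = 8 := by simpa using eq_intCast_iff_valMinAbs hL a 8 (by norm_num)
  have i9 : a = 9 ↔ a.valMinAbs = 9 := by simpa using eq_intCast_iff_valMinAbs hL a 9 (by norm_num)
  have i10 : a = 10 ↔ a.valMinAbs = 10 := by simpa using eq_intCast_iff_valMinAbs hL a 10 (by norm_num)
  have i11 : a = 11 ↔ a.valMinAbs = 11 := by simpa using eq_intCast_iff_valMinAbs hL a 11 (by norm_num)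
  simp only [wideU, sub_eq_iff_eq_add, ← eq_sub_iff_add_eq]
  norm_num only
  simp only [im8, im7, im6, im5, im4, im3, im2, im1, i0, i1, i2, i3, i4, i5, i6, i7, i8, i9, i10, i11]
  generalize a.valMinAbs = z
  by_cases hz : -8 ≤ z ∧ z ≤ 11
  · obtain ⟨hz1, hz2⟩ := hz
    interval_cases z <;> norm_num
  · have hf : ∀ c : ℤ, -8 ≤ c → c ≤ 11 → (z = c ↔ False) := fun c h1 h2 => ⟨fun h => hz ⟨by omega, by omega⟩, False.elim⟩
    simp only [hf (-8) (by norm_num) (by norm_num), hf (-7) (by norm_num) (by norm_num), hf (-6) (by norm_num) (by norm_num),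
      hf (-5) (by norm_num) (by norm_num), hf (-4) (by norm_num) (by norm_num), hf (-3) (by norm_num) (by norm_num),
      hf (-2) (by norm_num) (by norm_num), hf (-1) (by norm_num) (by norm_num), hf 0 (by norm_num) (by norm_num),
      hf 1 (by norm_num) (by norm_num), hf 2 (by norm_num) (by norm_num), hf 3 (by norm_num) (by norm_num),
      hf 4 (by norm_num) (by norm_num), hf 5 (by norm_num) (by norm_num), hf 6 (by norm_num) (by norm_num),
      hf 7 (by norm_num) (by norm_num), hf 8 (by norm_num) (by norm_num), hf 9 (by norm_num) (by norm_num),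
      hf 10 (by norm_num) (by norm_num), hf 11 (by norm_num) (by norm_num), or_false, if_false]
    norm_num

/-- **W4c as a `WeightedForestRowBound`** at `ρ = 14223/1000` on every torus of side `L ≥ 23`, with the weights in
`[1, 936/625]`. [folklore] -/
theorem weightedForestRowBound_sixteenClass (hL : 23 ≤ L) :
    WeightedForestRowBound (staggerForest L) (phaseWeight wideU (12521 / 10000)) (14223 / 1000) ∧
      (∀ y : Edge 4 L, (1 : ℝ) ≤ phaseWeight wideU (12521 / 10000 : ℝ) y) ∧
      ∀ y : Edge 4 L, phaseWeight wideU (12521 / 10000 : ℝ) y ≤ (936 / 625 : ℝ) := by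
  have hL4 : 4 ≤ L := by omega
  obtain ⟨w0, w1, w2, w3⟩ := wideU_window (L := L) hL4
  have hu : ∀ a : ZMod L, 0 ≤ wideU a := fun a => by linarith [(wideU_mem a).1]
  refine ⟨fun e he => weightedRow_phase_le hL4 hu (by norm_num) (M := 29679 / 10000) (by norm_num)
    (by rw [w0, w1]; norm_num) (by rw [w2, w3]; norm_num) (by norm_num) (sixteenClass_rows hL) e he, fun y => ?_,
    fun y => ?_⟩
  · unfold phaseWeight; split_ifs
    · norm_num
    · exact (wideU_mem (L := L) (stagPhase y.1 - 1)).1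
  · unfold phaseWeight; split_ifs
    · norm_num
    · exact (wideU_mem (L := L) (stagPhase y.1 - 1)).2

end Table

/-! ## 2. The sixteen-class door and the owned numbers -/

/-- **The sixteen-class weighted forest door** (`SU(2)`): every `β₀W ≤ 2/7` with `(14223/1000) β₀W (1/4) < 1` carries
the strong-coupling front (SC-b) — staggered forests with sixteen-class phase weights (W4c) on the odd tori of side
`≥ 23`, the proved gauge fixing and weighted frozen clustering (W3b), the quarter modulus up to `2/7`. [folklore] -/
theorem su2_strongCouplingFront_of_sixteenClass {β₀W : ℝ} (h27 : β₀W ≤ 2 / 7)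
    (hsmall : 14223 / 1000 * β₀W * (1 / 4) < 1) :
    CrossoverLedger.StrongCouplingFront (fundamentalLatticeRep 2) (β₀W / 2) :=
  su2_weightedForestDoor (ρ := 14223 / 1000) (vmin := 1) (vmax := 936 / 625) (by norm_num) (by norm_num)
    (by norm_num) (fun S => staggerForest (2 * S + 1)) (fun _ => stagRank)
    (fun _ => phaseWeight wideU (12521 / 10000)) 11
    (fun S hS => ⟨isRankedForest_stagger (by omega), weightedForestRowBound_sixteenClass (by omega)⟩)
    (oneLinkKRModulusSU2_of_le_twoSevenths h27) hsmall

/-- **SC-b BELOW `4000/14223 = 0.28123…`, HYPOTHESIS-FREE** (was `200/723` five-class, `5000/18513` two-class, `4/15`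
uniform): the `SU(2)` strong-coupling front at every Wilson `β₀W < 4000/14223` (tree coupling `β₀W/2 < 2000/14223`;
vacuous for `β₀W < 0`), through the sixteen-class weighted forest door at `ρ = 14223/1000`. [folklore] -/
theorem su2_strongCouplingFront_lt_sixteenClass {β₀W : ℝ} (hlt : β₀W < 4000 / 14223) :
    CrossoverLedger.StrongCouplingFront (fundamentalLatticeRep 2) (β₀W / 2) :=
  su2_strongCouplingFront_of_sixteenClass (by linarith) (by linarith)

/-- Instance: **SC-b AT Wilson `β_W = 0.28`** (tree coupling `0.14`; `0.28 < 4000/14223`). [folklore] -/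
theorem su2_strongCouplingFront_028 :
    CrossoverLedger.StrongCouplingFront (fundamentalLatticeRep 2) ((28 / 100 : ℝ) / 2) :=
  su2_strongCouplingFront_lt_sixteenClass (by norm_num)

/-- SC-b in the bare coupling: every `g² > 14223/1000` (`β_W = 4/g² < 4000/14223`) carries the `SU(2)` strong-coupling
front (was `g² > 14.46`). [folklore] -/
theorem su2_strongCouplingFront_of_bareCoupling {gsq : ℝ} (hg : 14223 / 1000 < gsq) :
    CrossoverLedger.StrongCouplingFront (fundamentalLatticeRep 2) ((4 / gsq) / 2) := by
  have hg0 : 0 < gsq := lt_trans (by norm_num) hg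
  refine su2_strongCouplingFront_lt_sixteenClass ?_
  rw [div_lt_iff₀ hg0]
  linarith

/-- **The sixteen-class door's ceiling is a theorem**: with the quarter modulus below `2/7` the door at
`ρ = 14223/1000` opens (some admissible `K₂`) exactly on `[0, 4000/14223)`. [folklore] -/
theorem su2_sixteenClassDoor_iff {βW : ℝ} (h0 : 0 ≤ βW) :
    (∃ K₂ : ℝ, 0 ≤ K₂ ∧ OneLinkKRModulusSU2 βW K₂ ∧ 14223 / 1000 * βW * K₂ < 1) ↔ βW < 4000 / 14223 := by
  have h := door_iff (D := 14223 / 1000) (by norm_num)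
    (fun b _ hb => oneLinkKRModulusSU2_of_le_twoSevenths (by rw [div_div_eq_mul_div] at hb; linarith)) h0
  rw [h, div_div_eq_mul_div]
  norm_num

/-- The numbers side by side: `4/15 < 5000/18513 < 200/723 < 0.28 < 4000/14223 < 2/7`, and
`4000/14223 = 4/(14223/1000)`. [folklore] -/
theorem sixteenClass_window_numbers :
    (4 : ℝ) / 15 < 5000 / 18513 ∧ (5000 : ℝ) / 18513 < 200 / 723 ∧ (200 : ℝ) / 723 < 28 / 100 ∧
      (28 : ℝ) / 100 < 4000 / 14223 ∧ (4000 : ℝ) / 14223 < 2 / 7 ∧ (4000 : ℝ) / 14223 = 4 / (14223 / 1000) := by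
  norm_num

/-! ## 3. Hand-off: the three hypothesis-free windows after the gen-14 lever -/

/-- **HAND-OFF (v2) — the three hypothesis-free strong-coupling windows of `SU(2)` in one theorem**, superseding the
SC-b conjunct `4/15` of `StrongCouplingFrontSummary.su2_strongCouplingFronts`: SC-a (DLR mass gap, tree coupling
`β_W/4`) below `β_W = 2/9`; SC-b (volume-uniform torus front, tree coupling `β_W/2`) below `β_W = 4000/14223 = 0.28123…`;
SC-c (open-time slab transfer-matrix gap at rate `krRate (14·β_W·¼)`) below `β_W = 2/7`. Units: `β_W = 4/g²`.
Observatory of the non-perturbative crossover; no mass-gap claim. [folklore] -/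
theorem su2_strongCouplingFronts_v2 {βW : ℝ} (h0 : 0 ≤ βW) :
    (βW < 2 / 9 → DLRMassGapAt 4 2 (βW / 4)) ∧
      (βW < 4000 / 14223 → CrossoverLedger.StrongCouplingFront (fundamentalLatticeRep 2) (βW / 2)) ∧
        (βW < 2 / 7 →
          CrossoverLedger.LatticeMassGap (fundamentalRep (Fin 2)) (βW / 2) (krRate (14 * βW * (1 / 4)))) :=
  ⟨(su2_strongCouplingFronts h0).1, fun h => su2_strongCouplingFront_lt_sixteenClass h,
    (su2_strongCouplingFronts h0).2.2⟩

/-- **The three ceilings (v2)**: with the modulus floor `K₂ ≥ 1/4` in and the quarter modulus up to `2/7` out, the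
doors with row constants `18` (single site, SC-a), `14223/1000` (sixteen-class weighted staggered forests, SC-b) and
`14` (temporal axial gauge, SC-c) open for an admissible `K₂` iff `β_W < 2/9`, `4000/14223`, `2/7`. [folklore] -/
theorem su2_strongCouplingFronts_ceilings_v2 {βW : ℝ} (h0 : 0 ≤ βW) :
    ((∃ K₂ : ℝ, 0 ≤ K₂ ∧ OneLinkKRModulusSU2 βW K₂ ∧ 18 * βW * K₂ < 1) ↔ βW < 2 / 9) ∧
      ((∃ K₂ : ℝ, 0 ≤ K₂ ∧ OneLinkKRModulusSU2 βW K₂ ∧ 14223 / 1000 * βW * K₂ < 1) ↔ βW < 4000 / 14223) ∧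
        ((∃ K₂ : ℝ, 0 ≤ K₂ ∧ OneLinkKRModulusSU2 βW K₂ ∧ 14 * βW * K₂ < 1) ↔ βW < 2 / 7) :=
  ⟨(su2_strongCouplingFronts_ceilings h0).1, su2_sixteenClassDoor_iff h0, (su2_strongCouplingFronts_ceilings h0).2.2⟩

end Summit.QuantumFields.BalabanUV.InfraRed.StrongCouplingSixteenClassFront
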